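import Summits.QuantumFields.YangMills.Theorems.BalabanUVNodesN15KingModelProp37AtRegularFieldVector
import Summits.QuantumFields.YangMills.Theorems.BalabanUVNodesN15KingModelProp37AtRegularFieldBox
import Summits.QuantumFields.YangMills.Theorems.BalabanUVNodesN15KingModelDeltaPropagatorSmallFactor

/-!
# N15 (NE2⁺, row s3 KING-MODEL ∕ RIEMANN-KERNEL RUNG) — PART Ζ-f (PACKAGE): KING 1986 §3.3 AT A REGULAR BACKGROUND `A ≠ 0` — PROPOSITION 3.7 BY NAME
# (torus; all three displays; boxes `Ω′`) AND THE `δ`-PROPAGATOR SMALL FACTOR, UNDER ONE NAME, WITH A NON-VACUITY WITNESS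

count-neutral helper of the pub-ymgap K3⁸ programme (`--supports stmt-QuantumFields-27366`); nothing here is a claim about Bałaban's
non-abelian `G(U)`, the continuum, ℝ⁴, OS axioms, a mass gap or the Clay problem.  One finite torus `T_ε` at fixed `ε`.

[King1986] = C. King, *The U(1) Higgs model. I. The continuum limit*, Commun. Math. Phys. **102** (1986) 649–677: Prop. 3.7 (3.63)–(3.65) p. 663,
*"Proposition 3.7 follows immediately from Theorem 3.3 and the scaling properties of the operators"* (p. 663), *"We note that Proposition 3.7
also holds for G^η_{(j)}(□′) and G^η_{(j)}(□′, Ã^{(k)}), since Theorem 3.3 gives bounds on these operators also."* (p. 665 [PDF 17] l. 27–29, read on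
the ×2 render `run/shared/lean/pub/pub-balaban/b2b-balaban-template/king-renders/1986-cmp102-king-u1-higgs-I-p017-x2.png`; King's box `□′` and
re-gauged field `Ã^{(k)}` of (3.43)–(3.46) are written `Ω′`, `A^{(k)}` in the headers of PARTS Ζ-a…Ζ-e), *"The propagator δG_k(□′, A^{(k)})(x, y) is
bounded by C exp[−δ₀|x − y| − δ₀p(L^kε)], since x, y ∈ □."* (p. 665 l. 32–33); p. 670 [PDF 22] l. 8–13 (render `…-p022-x2.png`): *"By using multiple
reflection representations, the propagators G^η_k and G^η_k(Ω) can be written in terms of the operator defined by (2.13) with free boundary conditions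
(and A = 0, of course) … so it is sufficient to prove Propositions 3.8 and 3.9 for the operator with free boundary conditions"* — the η-RATES are
`A = 0` statements; the background enters King's convergence proof through the `δ`-propagators (item (4)) and the expansions (3.48)∕(3.52).  What the rung's generation 22 landed, BY NAME (PARTS Ζ-a … Ζ-e, this namespace):
(1) ★★★ `prop37PrintedAt_king_regularField` — Prop 3.7 for the slices of [Ba1] (2.43) = King (2.17) AT THE LIVE REGULAR FIELD on `T_ε`;
(2) ★★★ `prop37PrintedAt_king_regularField_vector` — the same with the vector-field slice clause (3.64) filled in ([Ba3] (2.12));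
(3) ★★★ `prop37PrintedAt_king_regularField_box` — Prop 3.7 for `G^η_{(j)}(Ω′, A)` on big-block interval boxes, regularity ON `Ω′` only;
(4) ★★★ `king_deltaG_smallFactor_intervalBox` — the `δ`-propagator small factor `e^{−δ₀p}` of Prop 3.6's proof at a regular `A`;
(5) `prop37_regularField_family_nonempty` — the hypotheses of (1) are met (lit-balaban p26 `regularTorus_hypotheses_nonvacuous`) and King's
print-order schema `Prop37KingOrder` is exhibited on an explicit member (zero background through the regular-field pipeline).
Sources consumed by name: lit-balaban p26 `B3Ineq210RegularTorus` ∕ `B3Ineq211RegularTorus` ∕ `B3Ineq211RegularBoxCarrier` ((2.10)–(2.11) at a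
regular background, torus and boxes), `B3Ineq212VectorTorus` ((2.12)), p35 `B1Eq243HiggsModel.display243_univ` ((2.43) at every field), the
rung's g21 `thm33Printed_king_regularField_intervalBox` (Thm 3.3 with the `δ`-clauses live).

HONEST SCOPE.  A PACKAGE of landed results; nothing new is proved.  Block-norm reading of `|G(x,y)|` and (3.62) (gauge-invariant; the transport of
[Ba3] (2.11) is immaterial for it); `m², μ₀² > 0`; cubic tori of r14's `Shape` sub-family tiled by the cube sizes (torus statements) ∕ the general volume
family with `K₀ ∣ M` (box statements); constants existential per `(α, K₀)`.  NOT an η-rate (King's Props 3.8∕3.9 are `A = 0` statements, p. 670);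
NE2⁺ for Bałaban's `G(U)` NOT proved; N15 NOT discharged.  Unit `pub-ymgap-dag-n15-e` g22 (R141 (C) s3), PART Ζ-f.
-/

noncomputable section

namespace Summit.QuantumFields.YangMills.BalabanUVNodes.N15KingModelRung.RegularField

open Literature.MathematicalPhysics.QuantumFieldTheory.Balaban1983to89
open Literature.MathematicalPhysics.QuantumFieldTheory.Balaban1983to89.HiggsLattice (ChargeData)
open Literature.MathematicalPhysics.QuantumFieldTheory.Balaban1983to89.B1Eq211ZeroFieldTorus (Shape)
open Literature.MathematicalPhysics.QuantumFieldTheory.Balaban1983to89.B1TorusCubeCover (half)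
open Literature.MathematicalPhysics.QuantumFieldTheory.Balaban1983to89.B1Ineq225RegularBox (cellBox)
open Literature.MathematicalPhysics.QuantumFieldTheory.Balaban1983to89.B3Ineq210RegularTorus (regularTorus_hypotheses_nonvacuous)
open Literature.MathematicalPhysics.QuantumFieldTheory.King1986.SlicePropagator (Prop37PrintedAt Prop37KingOrder)
open Summit.QuantumFields.YangMills.BalabanUVNodes.N15KingModelRung.Curved (VSite bset bdistΩ sdistI legsK kingThm33DataAlong)

variable {N : ℕ}

/-- **NON-VACUITY + EXHIBIT**: above every cube-size threshold of `prop37KingOrder_king_zeroField_reg` there are an admissible cube size, a cubic torus of the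
sub-family and a level (`k = 1`) meeting every side condition, on which King's print-order Proposition 3.7 schema HOLDS for the regular-field datum at the
member `A = 0`: `Prop37KingOrder (kingSliceKernelsReg S C 0 m² a 1)`. [cite: King1986, Prop 3.7 p.663] [cite: Balaban1982Higgs1, (1.2) p.604] -/
theorem prop37_regularField_family_nonempty (d L : ℕ) (hd : 1 ≤ d) (hL : Odd L ∧ 1 < L) {a msq : ℝ} (ha : 0 < a) (hmsq : 0 < msq)
    (N : ℕ) (C : ChargeData N) :
    ∃ (K₀ : ℕ) (P : HiggsLattice.Params) (S : Shape P), P.d = d ∧ P.L = L ∧ K₀ ∣ P.M ∧ 3 * K₀ ≤ 2 * P.M ∧ 1 ≤ P.K ∧ P.mesh 1 ≤ 1 ∧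
      Prop37KingOrder (kingSliceKernelsReg S C (0 : HiggsLattice.VecField P 0) msq a 1) := by
  obtain ⟨K₀min, h⟩ := prop37KingOrder_king_zeroField_reg d L hL ha hmsq N C
  obtain ⟨K₀, hK₀, P, S, hPd, hPL, hK₀M, h3M, hK1, hmesh⟩ := regularTorus_hypotheses_nonvacuous d L hd hL K₀min
  exact ⟨K₀, P, S, hPd, hPL, hK₀M, h3M, hK1, hmesh, h K₀ hK₀ P S hPd hPL hK₀M h3M le_rfl hK1 hmesh⟩

/-- ★★★ **KING 1986 PROPOSITION 3.7 AND THE `δ`-PROPAGATOR SMALL FACTOR AT A REGULAR BACKGROUND `A ≠ 0`, UNDER ONE NAME** (the five landed results of PART Ζ,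
verbatim conjunction; see the module docstring for the dictionary). [cite: King1986, Prop 3.7 (3.63)–(3.65) p.663, p.665 l.22–27, Thm 3.3 p.656]
[cite: Balaban1983Higgs3, (2.10)–(2.12) p.426] [cite: Balaban1982Higgs1, Prop. 2.1 p.610, p.611 l.1–2, (2.43) p.612] -/
theorem king_prop37_regularField_package (d L : ℕ) (hd : 1 ≤ d) (hL : Odd L ∧ 1 < L) {a msq aV msqV : ℝ} (ha : 0 < a) (hmsq : 0 < msq)
    (haV : 0 < aV) (hmsqV : 0 < msqV) (N : ℕ) (C : ChargeData N) :
    -- (1) Prop 3.7 at a regular A on T_ε (PART Ζ-b)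
    (∃ K₀min : ℕ, ∀ {α : ℝ}, 0 < α → α < 1 →
      ∃ t Cst δ₀ : ℕ → ℝ, (∀ K₀, 0 < t K₀ ∧ 0 < Cst K₀ ∧ 0 < δ₀ K₀) ∧
      ∀ K₀ : ℕ, K₀min ≤ K₀ →
      ∀ (P : HiggsLattice.Params) (S : Shape P), P.d = d → P.L = L → K₀ ∣ P.M → 3 * K₀ ≤ 2 * P.M →
      ∀ {k : ℕ}, 1 ≤ k → k ≤ P.K → P.mesh k ≤ 1 →
      ∀ (A : HiggsLattice.VecField P 0) {δA : ℝ}, 0 ≤ δA →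
        (∀ (z : HiggsLattice.Site P 0) (μ ν : Fin P.d), |A ⟨z.shift ν, μ⟩ - A ⟨z, μ⟩| ≤ δA) →
        (P.L : ℝ) ^ k * δA * |C.e| ≤ t K₀ →
        Prop37PrintedAt α (kingSliceKernelsReg S C A msq a k) (Cst K₀) (δ₀ K₀)) ∧
    -- (2) with the vector-field slice clause (3.64) (PART Ζ-d)
    (∃ K₀min Kv : ℕ, 1 ≤ Kv ∧ ∀ {α : ℝ}, 0 < α → α < 1 →
      ∃ t Cst δ₀ : ℕ → ℝ, (∀ K₀, 0 < t K₀ ∧ 0 < Cst K₀ ∧ 0 < δ₀ K₀) ∧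
      ∀ K₀ : ℕ, K₀min ≤ K₀ →
      ∀ (P : HiggsLattice.Params) (S : Shape P), P.d = d → P.L = L → K₀ ∣ P.M → 3 * K₀ ≤ 2 * P.M → Kv ∣ P.M → 3 * Kv ≤ 2 * P.M →
      ∀ {k : ℕ}, 1 ≤ k → k ≤ P.K → P.mesh k ≤ 1 →
      ∀ (A : HiggsLattice.VecField P 0) {δA : ℝ}, 0 ≤ δA →
        (∀ (z : HiggsLattice.Site P 0) (μ ν : Fin P.d), |A ⟨z.shift ν, μ⟩ - A ⟨z, μ⟩| ≤ δA) →
        (P.L : ℝ) ^ k * δA * |C.e| ≤ t K₀ →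
        Prop37PrintedAt α (kingSliceKernelsRegV S C A msq a k msqV aV) (Cst K₀) (δ₀ K₀)) ∧
    -- (3) Prop 3.7 for G_(j)(Ω′, A) on big-block interval boxes, regularity on Ω′ only (PART Ζ-e)
    (∃ K₀min : ℕ, ∀ {α : ℝ}, 0 < α → α < 1 → ∀ K₀ : ℕ, K₀min ≤ K₀ → ∃ t Cst δ₀ : ℝ, 0 < t ∧ 0 < Cst ∧ 0 < δ₀ ∧
      ∀ (P : HiggsLattice.Params) (hP1 : 1 < P.L), P.d = d → P.L = L → K₀ ∣ P.M →
      ∀ {k : ℕ}, 1 ≤ k → k ≤ P.K → (∀ μ, 3 * half P k K₀ ≤ P.sitesPerDir 0 μ) → P.mesh k ≤ 1 →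
      ∀ (lo hi : Fin P.d → ℕ), (∀ μ, 2 * ((hi μ - lo μ) * half P k K₀) ≤ P.sitesPerDir 0 μ) →
      ∀ (A : HiggsLattice.VecField P 0) {δA : ℝ}, 0 ≤ δA →
        (∀ z ∈ cellBox k K₀ (fun μ => Finset.Ico (lo μ) (hi μ)), ∀ μ ν : Fin P.d, |A ⟨z.shift ν, μ⟩ - A ⟨z, μ⟩| ≤ δA) →
        (P.L : ℝ) ^ k * δA * |C.e| ≤ t →
        Prop37PrintedAt α (kingSliceKernelsRegBox hP1 C lo hi A msq a k K₀) Cst δ₀) ∧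
    -- (4) the δ-propagator small factor of Prop 3.6's proof at a regular A (PART Ζ-c)
    (∃ K₀min : ℕ, ∀ K₀ : ℕ, K₀min ≤ K₀ → L ∣ K₀ → ∃ t : ℝ, 0 < t ∧
      ∀ (P : HiggsLattice.Params) (_S : Shape P), P.d = d → P.L = L → K₀ ∣ P.M → 3 * K₀ ≤ 2 * P.M →
      ∀ {k : ℕ}, 1 ≤ k → k < P.K → P.mesh k ≤ 1 →
      ∀ (lo hi : Fin P.d → ℕ), (∀ μ, 2 * ((hi μ - lo μ) * half P k K₀) ≤ P.sitesPerDir 0 μ) →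
      ∀ (A : HiggsLattice.VecField P 0) {δ : ℝ}, 0 ≤ δ →
        (∀ (z : HiggsLattice.Site P 0) (μ ν : Fin P.d), |A ⟨z.shift ν, μ⟩ - A ⟨z, μ⟩| ≤ δ) →
        (P.L : ℝ) ^ k * δ * |C.e| ≤ t →
        ∃ δ₀ Cst : ℝ, 0 < δ₀ ∧
          ∀ (p : ℝ) (f : VSite (bset (cellBox k K₀ (fun μ => Finset.Ico (lo μ) (hi μ)))) → EuclideanSpace ℝ (Fin N))
            (x : VSite (bset (cellBox k K₀ (fun μ => Finset.Ico (lo μ) (hi μ))))),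
            p ≤ bdistΩ (cellBox k K₀ (fun μ => Finset.Ico (lo μ) (hi μ))) x.1 / (P.L : ℝ) ^ k →
            ‖(kingThm33DataAlong C P k (cellBox k K₀ (fun μ => Finset.Ico (lo μ) (hi μ)))
                (bset (cellBox k K₀ (fun μ => Finset.Ico (lo μ) (hi μ)))) (fun y x => legsK y x) A a msq).δG f x‖
                ≤ Cst * Real.exp (-(δ₀ * (sdistI x f / (P.L : ℝ) ^ k))) * ‖f‖ * Real.exp (-(δ₀ * p)) ∧
            ∀ μ : Fin P.d,
              ‖(kingThm33DataAlong C P k (cellBox k K₀ (fun μ => Finset.Ico (lo μ) (hi μ)))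
                  (bset (cellBox k K₀ (fun μ => Finset.Ico (lo μ) (hi μ)))) (fun y x => legsK y x) A a msq).δDG μ f x‖
                ≤ Cst * Real.exp (-(δ₀ * (sdistI x f / (P.L : ℝ) ^ k))) * ‖f‖ * Real.exp (-(δ₀ * p))) ∧
    -- (5) non-vacuity + the print-order schema exhibited on a member
    (∃ (K₀ : ℕ) (P : HiggsLattice.Params) (S : Shape P), P.d = d ∧ P.L = L ∧ K₀ ∣ P.M ∧ 3 * K₀ ≤ 2 * P.M ∧ 1 ≤ P.K ∧ P.mesh 1 ≤ 1 ∧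
      Prop37KingOrder (kingSliceKernelsReg S C (0 : HiggsLattice.VecField P 0) msq a 1)) :=
  ⟨prop37PrintedAt_king_regularField d L hL ha hmsq N C,
   prop37PrintedAt_king_regularField_vector d L hd hL ha hmsq haV hmsqV N C,
   prop37PrintedAt_king_regularField_box d L hd hL.2 ha hmsq N C,
   king_deltaG_smallFactor_intervalBox d L hd hL ha hmsq N C,
   prop37_regularField_family_nonempty d L hd hL ha hmsq N C⟩

end Summit.QuantumFields.YangMills.BalabanUVNodes.N15KingModelRung.RegularField

end
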